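import Summits.AtomisticToContinuum.FouriersLaw.Theses.MatthiessenLadder
import Summits.AtomisticToContinuum.FouriersLaw.Theorems.MatthiessenLadderPrefixSteadyStatesStubPrefixWindowDecay
import Summits.AtomisticToContinuum.FouriersLaw.Theorems.MatthiessenLadderPrefixSteadyStatesStubPrefixExpBound
import Summits.AtomisticToContinuum.FouriersLaw.Theorems.MatthiessenLadderPrefixSteadyStatesStubPrefixLimitDissipation
import Summits.AtomisticToContinuum.FouriersLaw.Theorems.MatthiessenLadderPrefixSteadyStatesStubPrefixHostObservability
import Literature.MathematicalPhysics.KineticTheory.PrefixRungAccounting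
import Literature.Probability.Process.BrownianSupTail
import HarnessLib

/-!
# `stub_prefixUniformDecay`: CEHR Theorem 5.1 for the MIXED rung of the Matthiessen ladder, with a temperature ceiling

`--supports stmt-AtomisticToContinuum-12778` (crux `MatthiessenLadder.PrefixSteadyStates`, line `registered`,
THE remaining registered stub of skeleton r16). For the prefix cell chain `cellChain ω₂ lam β γ (· < k)`,
`0 < k < N`, a ceiling `Tmax`, `0 < θ < 1/Tmax` and a time `t* > 0` there is ONE energy threshold `E₁`
such that `P_{t*} e^{θH}(z) ≤ e^{θH(z)}/2` for `H(z) ≥ E₁` and all bath temperatures `T_L, T_R ≤ Tmax`.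
This is Cuneo–Eckmann–Hairer–Rey-Bellet 2018 Thm 5.1 / Rem 5.2 for a chain OUTSIDE their Condition C3
(interaction degree 4 on the cells, 2 on the host; Rem 2.11). Proof = the lead's two-block plan
(crux memo §7), all of whose parts are landed:

* the pathwise core `prefixRung_pathwise_energy_drop` (Literature/PrefixRungAccounting.lean: fine grid,
  cell-block regime via CEHR §5.1 closeness + Prop 5.14 for the limit cell chain, host-block regime via
  the linear observability of the damped harmonic host with the interface as bounded forcing,
  `twoScale_accounting`, two-sided energy bookkeeping), fed with the landed stubs
  `stub_prefixLimitDissipation` (Prop 5.14) and `stub_prefixHostObservability`;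
* the noise of the Langevin kernels on the good event `{sup_{[0,t*]} |B^{1,2}| ≤ a}` is a bath-supported
  momentum path of size `≤ δ₀K` (`a = δ₀K/(2√(2γTmax)+1)`), so the pathwise solution loses `ρ₀K⁴`;
* the landed `stub_prefixWindowDecay` (Hölder + CEHR (3.4) = landed `stub_prefixExpBound`) and the
  Brownian tail bound `measure_compl_goodEvent_le` finish: both error terms are `≤ 1/4` above `E₁`.
-/

noncomputable section

open MeasureTheory ProbabilityTheory Filter Topology Set Metric Function
open scoped NNReal ENNReal

namespace Summit.AtomisticToContinuum.FouriersLaw.Theorems.PrefixSteadyStates.LineRegistered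

open Literature.MathematicalPhysics.KineticTheory.HeatConduction
open Literature.MathematicalPhysics.KineticTheory Literature.Probability.Process OscillatorChain

/-- The noise path of the Langevin kernels of a site chain read componentwise: `η(ω)(t)ᵢ =
[i = 0] √(2γT_L) B¹_{t⁺} + [i = N-1] √(2γT_R) B²_{t⁺}`. [folklore] -/
theorem pairNoise_noiseVec_eq (P : SiteChain) (N : ℕ) (T_L T_R : ℝ) (w : WienerPair) :
    pairNoise (P.noiseVecL N T_L) (P.noiseVecR N T_R) (pairPath w) =
      fun t => ((0 : Fin N → ℝ), fun i : Fin N =>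
        brownian t.toNNReal w.1 * (if i.val = 0 then Real.sqrt (2 * P.γ * T_L) else 0) +
          brownian t.toNNReal w.2 * (if i.val = N - 1 then Real.sqrt (2 * P.γ * T_R) else 0)) := by
  funext t
  rw [Literature.MathematicalPhysics.KineticTheory.pairNoise_pairPath]
  ext i
  · simp [SiteChain.noiseVecL, SiteChain.noiseVecR, bathVec]
  · simp [SiteChain.noiseVecL, SiteChain.noiseVecR, bathVec]

set_option maxHeartbeats 1600000 in
/-- **Registered stub `stub_prefixUniformDecay` (r12): CEHR Theorem 5.1 with a temperature ceiling for
the MIXED rung** — the last open stub of crux `PrefixSteadyStates`.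
[cite: CuneoEckmannHairerReyBellet2018, Thm 5.1 and Rem 5.2] -/
theorem stub_prefixUniformDecay :
    ∀ ω₂ lam β γ : ℝ, 0 < ω₂ → 0 < lam → 0 < β → 0 < γ → ∀ k N : ℕ, 0 < k → k < N →
      ∀ Tmax : ℝ, 0 < Tmax → ∀ θ : ℝ, 0 < θ → θ < 1 / Tmax → ∀ tstar : ℝ≥0, 0 < tstar →
        ∃ E₁ : ℝ, ∀ T_L T_R : ℝ, 0 < T_L → 0 < T_R → T_L ≤ Tmax → T_R ≤ Tmax →
          ∀ z : PhaseSpace N,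
            E₁ ≤ (cellChain ω₂ lam β γ (fun i => decide (i < k))).hamiltonian N z →
            ∫⁻ y, ENNReal.ofReal
                (Real.exp (θ * (cellChain ω₂ lam β γ (fun i => decide (i < k))).hamiltonian N y))
                ∂((cellChain ω₂ lam β γ (fun i => decide (i < k))).langevinKernel N T_L T_R tstar z) ≤
              ENNReal.ofReal
                (Real.exp (θ * (cellChain ω₂ lam β γ (fun i => decide (i < k))).hamiltonian N z) / 2) := by
  intro ω₂ lam β γ hω hl hβ hγ k N hk hkN Tmax hTmax θ hθ hθT tstar htstar
  obtain ⟨n, rfl⟩ : ∃ n, N = k + 1 + n := ⟨N - (k + 1), by omega⟩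
  set N := k + 1 + n with hNdef
  set P := cellChain ω₂ lam β γ (fun i => decide (i < k)) with hP
  have hUC := cellChain_uniformlyConfining hω hl.le hβ.le hγ.le (fun i => decide (i < k))
  have hN : 0 < N := by rw [hNdef]; omega
  have ht : (0 : ℝ) < (tstar : ℝ) := by exact_mod_cast htstar
  -- the Hölder exponent
  have hθT0 : 0 < θ * Tmax := mul_pos hθ hTmax
  have hθT1 : θ * Tmax < 1 := by rwa [lt_div_iff₀ hTmax] at hθT
  obtain ⟨p, hpdef⟩ : ∃ p : ℝ, p = (1 / (θ * Tmax) + 1) / 2 := ⟨_, rfl⟩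
  have hp1 : 1 < p := by
    have h1 : 1 < 1 / (θ * Tmax) := by rw [lt_div_iff₀ hθT0]; linarith only [hθT1]
    rw [hpdef]; linarith only [h1]
  have hpθ : p * θ < 1 / Tmax := by
    rw [hpdef, lt_div_iff₀ hTmax]
    have e : (1 / (θ * Tmax) + 1) / 2 * θ * Tmax = (1 + θ * Tmax) / 2 := by field_simp
    rw [e]; linarith only [hθT1]
  -- the two dynamical inputs, landed
  set c₁ := pinnedChainScaleC ω₂ lam β γ N with hc₁
  have hc₁0 : 0 ≤ c₁ := pinnedChainScaleC_nonneg hω.le hl.le hβ.le hγ.le N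
  obtain ⟨ε₁, hε₁, hS5⟩ := stub_prefixLimitDissipation lam β hl hβ k hk (1 / 8) (c₁ + 1) (tstar / (tstar + 2))
    (by norm_num) (by linarith only [hc₁0]) (by positivity)
  have hS4ex : ∃ c₀ C₀ : ℝ, 0 < c₀ ∧ 0 ≤ C₀ ∧ ∀ hn : 0 < n, ∀ (Mu Mξ : ℝ) (u ξ : ℝ → ℝ) (X : ℝ → PhaseSpace n),
      Continuous u → Continuous ξ → Continuous X →
      (∀ t ∈ Icc (0 : ℝ) (tstar / 2), |u t| ≤ Mu) → (∀ t ∈ Icc (0 : ℝ) (tstar / 2), |ξ t| ≤ Mξ) →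
      (∀ t ∈ Icc (0 : ℝ) (tstar / 2),
        X t = X 0 + ((0 : Fin n → ℝ), fun j : Fin n => if j.val = n - 1 then ξ t else 0) +
          ∫ s in (0 : ℝ)..t,
            ((X s).2, fun j : Fin n =>
              -(ω₂ * (X s).1 j) +
                (if h : j.val + 1 < n then (X s).1 ⟨j.val + 1, h⟩ - (X s).1 j else 0) -
                (if h : 0 < j.val then (X s).1 j - (X s).1 ⟨j.val - 1, by omega⟩
                  else (X s).1 j - u s) -
                (if j.val = n - 1 then γ * (X s).2 j else 0))) →
      c₀ * (∑ j, ((X 0).1 j ^ 2 + (X 0).2 j ^ 2)) - C₀ * (Mu ^ 2 + Mξ ^ 2) ≤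
        γ * ∫ s in (0 : ℝ)..tstar / 2, ((X s).2 ⟨n - 1, by omega⟩ - ξ s) ^ 2 := by
    rcases Nat.eq_zero_or_pos n with hn0 | hnpos
    · exact ⟨1, 0, one_pos, le_rfl, fun hn => absurd hn (by omega)⟩
    · obtain ⟨c₀, C₀, hc₀, hC₀, h⟩ := stub_prefixHostObservability ω₂ γ (tstar / 2) hω hγ (by positivity) n hnpos
      exact ⟨c₀, C₀, hc₀, hC₀, fun _ => h⟩
  obtain ⟨c₀, C₀, hc₀, hC₀, hS4⟩ := hS4ex
  -- the pathwise core
  obtain ⟨δ₀, ρ₀, K₀, hδ₀, hρ₀, hK₀, hdrop⟩ := prefixRung_pathwise_energy_drop (ω₂ := ω₂) (lam := lam)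
    (β := β) (γ := γ) (k := k) (n := n) hω hl hβ hγ hk (tstar := tstar) ht hε₁ hc₀ hC₀ hS5 hS4
  -- the probabilistic constants
  set cs : ℝ := Real.sqrt (2 * γ * Tmax) + Real.sqrt (2 * γ * Tmax) + 1 with hcs
  have hcs1 : 1 ≤ cs := by rw [hcs]; linarith only [Real.sqrt_nonneg (2 * γ * Tmax)]
  have hcs0 : 0 < cs := by linarith only [hcs1]
  set G : ℝ := Real.exp (θ * γ * (Tmax + Tmax) * tstar) with hG
  have hG0 : 0 < G := Real.exp_pos _
  set r : ℝ := 1 - p⁻¹ with hr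
  have hr0 : 0 < r := by rw [hr]; have := inv_lt_one_of_one_lt₀ hp1; linarith only [this]
  set εb : ℝ := (1 / (4 * G)) ^ r⁻¹ with hεb
  have hεb0 : 0 < εb := by rw [hεb]; exact Real.rpow_pos_of_pos (by positivity) _
  set Q : ℝ := tstar + (2 * tstar / Real.sqrt εb + 1) with hQ
  have hQ0 : 0 < Q := by rw [hQ]; positivity
  set K₁ : ℝ := cs * Real.sqrt Q / δ₀ with hK₁
  have hK₁0 : 0 ≤ K₁ := by rw [hK₁]; positivity
  set E₁ : ℝ := max (max (K₀ ^ 4) (K₁ ^ 4)) (max (Real.log 4 / (θ * ρ₀)) 1) with hE₁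
  refine ⟨E₁, ?_⟩
  intro T_L T_R hL hR hLT hRT z hz
  -- the scale `K = H(z)^{1/4}`
  set Hz := P.hamiltonian N z with hHz
  have hHz1 : 1 ≤ Hz := ((le_max_right _ _).trans (le_max_right _ _)).trans hz
  have hHz0 : 0 ≤ Hz := zero_le_one.trans hHz1
  set K : ℝ := Real.sqrt (Real.sqrt Hz) with hK
  have hK0' : 0 ≤ K := Real.sqrt_nonneg _
  have hK4 : K ^ 4 = Hz := by
    rw [hK, show (4 : ℕ) = 2 * 2 from rfl, pow_mul, Real.sq_sqrt (Real.sqrt_nonneg _), Real.sq_sqrt hHz0]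
  have hKK₀ : K₀ ≤ K := by
    have h : K₀ ^ 4 ≤ K ^ 4 := by rw [hK4]; exact ((le_max_left _ _).trans (le_max_left _ _)).trans hz
    exact le_of_pow_le_pow_left₀ (by norm_num) hK0' h
  have hKK₁ : K₁ ≤ K := by
    have h : K₁ ^ 4 ≤ K ^ 4 := by rw [hK4]; exact ((le_max_right _ _).trans (le_max_left _ _)).trans hz
    exact le_of_pow_le_pow_left₀ (by norm_num) hK0' h
  have hK1 : 1 ≤ K := hK₀.trans hKK₀
  have hK0 : 0 < K := by linarith only [hK1]
  have hKlog : Real.log 4 / (θ * ρ₀) ≤ K ^ 4 := by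
    rw [hK4]; exact ((le_max_left _ _).trans (le_max_right _ _)).trans hz
  -- the noise on the good event
  set a : ℝ := δ₀ * K / cs with ha
  have ha0 : 0 ≤ a := by rw [ha]; positivity
  set η : WienerPair → ℝ → Fin N → ℝ := fun w t i =>
    brownian t.toNNReal w.1 * (if i.val = 0 then Real.sqrt (2 * P.γ * T_L) else 0) +
      brownian t.toNNReal w.2 * (if i.val = N - 1 then Real.sqrt (2 * P.γ * T_R) else 0) with hη
  have hnoise : ∀ w : WienerPair, pairNoise (P.noiseVecL N T_L) (P.noiseVecR N T_R) (pairPath w) =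
      fun t => ((0 : Fin N → ℝ), η w t) := fun w => pairNoise_noiseVec_eq P N T_L T_R w
  have hηc : ∀ w : WienerPair, Continuous (η w) := by
    intro w
    have h := continuous_pairNoise (P.noiseVecL N T_L) (P.noiseVecR N T_R) (pairPath w)
    rw [hnoise w] at h
    exact continuous_snd.comp h
  have hsupp : ∀ (w : WienerPair) (t : ℝ) (i : Fin N), i.val ≠ 0 → i.val + 1 ≠ k + 1 + n → η w t i = 0 := by
    intro w t i hi0 hiN
    have hi2 : i.val < k + 1 + n := i.isLt
    have hN' : N = k + 1 + n := hNdef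
    have h1 : ¬ (i.val = N - 1) := by
      intro h
      apply hiN
      omega
    simp only [hη, if_neg hi0, if_neg h1, mul_zero, add_zero]
  have hγP : P.γ = γ := rfl
  have hcL : Real.sqrt (2 * P.γ * T_L) ≤ Real.sqrt (2 * γ * Tmax) := by
    rw [hγP]; exact Real.sqrt_le_sqrt (by nlinarith [hγ.le])
  have hcR : Real.sqrt (2 * P.γ * T_R) ≤ Real.sqrt (2 * γ * Tmax) := by
    rw [hγP]; exact Real.sqrt_le_sqrt (by nlinarith [hγ.le])
  have hbound : ∀ w ∈ goodEvent a tstar, ∀ t ∈ Icc (0 : ℝ) tstar, ‖η w t‖ ≤ δ₀ * K := by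
    intro w hw t htt
    have hB := abs_brownian_toNNReal_le_of_mem_goodEvent hw htt.2
    refine (pi_norm_le_iff_of_nonneg (by positivity)).2 fun i => ?_
    rw [Real.norm_eq_abs]
    have h1 : |brownian t.toNNReal w.1 * (if i.val = 0 then Real.sqrt (2 * P.γ * T_L) else 0)| ≤
        a * Real.sqrt (2 * γ * Tmax) := by
      rw [abs_mul]
      refine mul_le_mul hB.1 ?_ (abs_nonneg _) ha0
      split_ifs
      · rw [abs_of_nonneg (Real.sqrt_nonneg _)]; exact hcL
      · rw [abs_zero]; exact Real.sqrt_nonneg _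
    have h2 : |brownian t.toNNReal w.2 * (if i.val = N - 1 then Real.sqrt (2 * P.γ * T_R) else 0)| ≤
        a * Real.sqrt (2 * γ * Tmax) := by
      rw [abs_mul]
      refine mul_le_mul hB.2 ?_ (abs_nonneg _) ha0
      split_ifs
      · rw [abs_of_nonneg (Real.sqrt_nonneg _)]; exact hcR
      · rw [abs_zero]; exact Real.sqrt_nonneg _
    calc |η w t i| ≤ |brownian t.toNNReal w.1 * (if i.val = 0 then Real.sqrt (2 * P.γ * T_L) else 0)| +
          |brownian t.toNNReal w.2 * (if i.val = N - 1 then Real.sqrt (2 * P.γ * T_R) else 0)| := abs_add_le _ _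
      _ ≤ a * Real.sqrt (2 * γ * Tmax) + a * Real.sqrt (2 * γ * Tmax) := add_le_add h1 h2
      _ ≤ a * cs := by rw [hcs]; nlinarith [ha0]
      _ = δ₀ * K := by rw [ha]; field_simp
  -- the pathwise drop on the good event
  set Dθ : ℝ := θ * ρ₀ * K ^ 4 with hDθ
  have hgood : ∀ w ∈ goodEvent a tstar,
      θ * P.hamiltonian N (P.langevinSolMap N T_L T_R tstar z (pairPath w)) ≤ θ * P.hamiltonian N z - Dθ := by
    intro w hw
    have hsol : P.langevinSolMap N T_L T_R tstar z (pairPath w) =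
        drivenFlow (P.langevinDrift N) z (fun s => ((0 : Fin N → ℝ), η w s)) tstar := by
      show sdeSolMap (P.langevinDrift N) (P.noiseVecL N T_L) (P.noiseVecR N T_R) tstar z (pairPath w) = _
      unfold sdeSolMap
      rw [hnoise w]
    have h := hdrop K hKK₀ z hK4.symm (η w) (hηc w) (hsupp w) (hbound w hw)
    rw [hsol, ← hHz]
    have h2 : θ * P.hamiltonian N (drivenFlow (P.langevinDrift N) z (fun s => ((0 : Fin N → ℝ), η w s)) tstar) ≤
        θ * (K ^ 4 - ρ₀ * K ^ 4) := mul_le_mul_of_nonneg_left h hθ.le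
    rw [hDθ, ← hK4]
    linarith only [h2]
  -- the window estimate from the landed shell stub, with the landed (3.4)
  have h34 := stub_prefixExpBound ω₂ lam β γ hω hl.le hβ.le hγ (fun i => decide (i < k)) N hN T_L T_R hL hR
  have hmax : max T_L T_R ≤ Tmax := max_le hLT hRT
  have hmax0 : 0 < max T_L T_R := lt_max_of_lt_left hL
  have hpθ' : p * θ < 1 / max T_L T_R :=
    hpθ.trans_le (one_div_le_one_div_of_le hmax0 hmax)
  have hW := stub_prefixWindowDecay ω₂ lam β γ hω hl.le hβ.le hγ (fun i => decide (i < k)) N hN T_L T_R hL hR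
    h34 θ hθ p hp1 hpθ' tstar a Dθ z hgood
  refine hW.trans ?_
  -- both error terms are `≤ 1/4`
  have hexp1 : Real.exp (-Dθ) ≤ 1 / 4 := by
    have h1 : Real.log 4 ≤ Dθ := by
      rw [hDθ]
      have := (div_le_iff₀ (mul_pos hθ hρ₀)).1 hKlog
      linarith only [this]
    calc Real.exp (-Dθ) ≤ Real.exp (-Real.log 4) := Real.exp_le_exp.2 (by linarith only [h1])
      _ = 1 / 4 := by rw [Real.exp_neg, Real.exp_log (by norm_num)]; norm_num
  have hGle : Real.exp (θ * γ * (T_L + T_R) * tstar) ≤ G := by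
    rw [hG]
    refine Real.exp_le_exp.2 (mul_le_mul_of_nonneg_right (mul_le_mul_of_nonneg_left (add_le_add hLT hRT)
      (by positivity)) (by positivity))
  -- the bad event
  have ha2 : Q ≤ a ^ 2 := by
    have h1 : cs * Real.sqrt Q ≤ δ₀ * K := by
      have := mul_le_mul_of_nonneg_left hKK₁ hδ₀.le
      rw [hK₁, mul_div_cancel₀ _ hδ₀.ne'] at this
      linarith only [this]
    have h2 : Real.sqrt Q ≤ a := by
      rw [ha, le_div_iff₀ hcs0]; linarith only [h1]
    calc Q = Real.sqrt Q ^ 2 := (Real.sq_sqrt hQ0.le).symm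
      _ ≤ a ^ 2 := pow_le_pow_left₀ (Real.sqrt_nonneg _) h2 2
  have hat : (tstar : ℝ) < a ^ 2 := by
    have h1 : 0 < 2 * (tstar : ℝ) / Real.sqrt εb + 1 := by positivity
    have h2 : (tstar : ℝ) < Q := by rw [hQ]; linarith only [h1]
    exact h2.trans_le ha2
  have hbad_real : 2 * (2 * (tstar : ℝ) ^ 2 / (a ^ 2 - tstar) ^ 2) ≤ εb := by
    have hs0 : 0 < Real.sqrt εb := Real.sqrt_pos.2 hεb0
    have h1 : 2 * tstar / Real.sqrt εb + 1 ≤ a ^ 2 - tstar := by rw [hQ] at ha2; linarith only [ha2]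
    have h2 : 0 < a ^ 2 - tstar := by linarith only [hat]
    have h3 : 2 * tstar / Real.sqrt εb ≤ a ^ 2 - tstar := by linarith only [h1]
    -- `(a² - t*)² ≥ 4t*²/εb`
    have h4 : (2 * tstar / Real.sqrt εb) ^ 2 ≤ (a ^ 2 - tstar) ^ 2 :=
      pow_le_pow_left₀ (by positivity) h3 2
    have h5 : (2 * (tstar : ℝ) / Real.sqrt εb) ^ 2 = 4 * tstar ^ 2 / εb := by
      rw [div_pow, Real.sq_sqrt hεb0.le]; ring
    rw [h5] at h4
    rw [show 2 * (2 * (tstar : ℝ) ^ 2 / (a ^ 2 - tstar) ^ 2) = 4 * tstar ^ 2 / (a ^ 2 - tstar) ^ 2 by ring,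
      div_le_iff₀ (by positivity)]
    have := (div_le_iff₀ hεb0).1 h4
    linarith only [this]
  have hbad : wienerPair (goodEvent a tstar)ᶜ ≤ ENNReal.ofReal εb := by
    refine (measure_compl_goodEvent_le ha0 tstar hat).trans ?_
    rw [← ENNReal.ofReal_ofNat 2, ← ENNReal.ofReal_mul (by norm_num)]
    exact ENNReal.ofReal_le_ofReal hbad_real
  have hbad_r : (wienerPair (goodEvent a tstar)ᶜ) ^ (1 - p⁻¹) ≤ ENNReal.ofReal (1 / (4 * G)) := by
    rw [← hr]
    calc (wienerPair (goodEvent a tstar)ᶜ) ^ r ≤ (ENNReal.ofReal εb) ^ r := ENNReal.rpow_le_rpow hbad hr0.le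
      _ = ENNReal.ofReal (εb ^ r) := ENNReal.ofReal_rpow_of_nonneg hεb0.le hr0.le
      _ = ENNReal.ofReal (1 / (4 * G)) := by
          rw [hεb, Real.rpow_inv_rpow (by positivity) hr0.ne']
  have hsecond : ENNReal.ofReal (Real.exp (θ * γ * (T_L + T_R) * tstar)) *
      (wienerPair (goodEvent a tstar)ᶜ) ^ (1 - p⁻¹) ≤ ENNReal.ofReal (1 / 4) := by
    calc _ ≤ ENNReal.ofReal G * ENNReal.ofReal (1 / (4 * G)) := by
          gcongr
      _ = ENNReal.ofReal (1 / 4) := by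
          rw [← ENNReal.ofReal_mul hG0.le]
          congr 1; field_simp
  have hbracket : ENNReal.ofReal (Real.exp (-Dθ)) + ENNReal.ofReal (Real.exp (θ * γ * (T_L + T_R) * tstar)) *
      (wienerPair (goodEvent a tstar)ᶜ) ^ (1 - p⁻¹) ≤ ENNReal.ofReal (1 / 2) := by
    calc _ ≤ ENNReal.ofReal (1 / 4) + ENNReal.ofReal (1 / 4) := add_le_add (ENNReal.ofReal_le_ofReal hexp1) hsecond
      _ = ENNReal.ofReal (1 / 2) := by rw [← ENNReal.ofReal_add (by norm_num) (by norm_num)]; norm_num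
  calc ENNReal.ofReal (Real.exp (θ * P.hamiltonian N z)) *
        (ENNReal.ofReal (Real.exp (-Dθ)) + ENNReal.ofReal (Real.exp (θ * γ * (T_L + T_R) * tstar)) *
          (wienerPair (goodEvent a tstar)ᶜ) ^ (1 - p⁻¹))
      ≤ ENNReal.ofReal (Real.exp (θ * P.hamiltonian N z)) * ENNReal.ofReal (1 / 2) := by gcongr
    _ = ENNReal.ofReal (Real.exp (θ * P.hamiltonian N z) / 2) := by
        rw [← ENNReal.ofReal_mul (Real.exp_pos _).le]; congr 1; ring

end Summit.AtomisticToContinuum.FouriersLaw.Theorems.PrefixSteadyStates.LineRegistered
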